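import Literature.Geometry.Lorentzian.StationaryOrbitHorizontal
import HarnessLib

/-!
# The horizontal lift is equivariant under the stationary flow; `g` on horizontal lifts is
# constant along orbits (well-definedness of Anderson's quotient metric `g_S`)

M. T. Anderson, *On stationary vacuum solutions to the Einstein equations*, Ann. Henri Poincaré 1
(2000), §0: "The metric `g = g_M` restricted to the horizontal subspaces of `TM`, i.e. the
orthogonal complement of `⟨X⟩ ⊂ TM` then induces a Riemannian metric `g_S` on `S`." The inner
product `g_S(ζ, ζ') := g_y(H_y ζ, H_y ζ')` of two tangent vectors of `S` at `π y`, computed through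
their horizontal lifts at `y` (`IsStationaryKilling.existsUnique_horizontal_lift`,
`StationaryOrbitHorizontal.lean`), must not depend on the point `y` chosen on the orbit. This file
proves that, for the flow `θ` of the stationary Killing field:

* `velocity_comp_of_mdifferentiableAt` — chain rule for velocities (bookkeeping);
* `IsKillingField.mfderiv_flow_apply_self` — **the flow preserves its generator**:
  `dθₜ(X y) = X(θₜ y)` (differentiate the group law `θ(t, θ(s, y)) = θ(t + s, y)` in `s`);
* `IsStationaryKilling.mfderiv_orbitProj_mfderiv_flow` — **`dπ ∘ dθₜ = dπ`** (`π ∘ θₜ = π`);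
* `IsStationaryKilling.horizontal_mfderiv_flow` — **`dθₜ` maps horizontal vectors at `y` to
  horizontal vectors at `θₜ y`** (flow maps are isometries, `IsKillingField.val_mfderiv_flow`,
  and preserve `X`);
* `IsStationaryKilling.horizontal_lift_flow_eq` — hence **`H_{θₜ y} ζ = dθₜ(H_y ζ)`** (uniqueness of
  the horizontal lift);
* `IsStationaryKilling.val_horizontal_lift_flow` — and **`g_{θₜ y}(H ζ, H ζ') = g_y(H ζ, H ζ')`**:
  the horizontal inner product is constant along orbits, i.e. `g_S` is well defined on `S`
  (Anderson 2000, §0; O'Neill 1983, Ch. 7, Def. 7.44, semi-Riemannian submersions);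
* the bundled form `Spacetime.IsStationaryKilling.val_horizontal_lift_flow`.

Not here: `g_S` as a (smooth) Riemannian metric on the manifold `S`. Everything is proved; no
definitions, no named facts.

## References

* M. T. Anderson, Ann. Henri Poincaré 1 (2000) 977–994, arXiv:gr-qc/0001091, §0, §1.1 (key
  `Anderson2000`).
* B. O'Neill, *Semi-Riemannian geometry* (1983), Ch. 7, Def. 7.44 ff.; Ch. 9, Prop. 9.23 (key
  `ONeill1983`).
-/

noncomputable section

open Bundle Set Filter Function Manifold TopologicalSpace
open scoped ContDiff Topology Manifold

namespace Literature.Geometry.Lorentzian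

/-! ### Velocities of composites; the flow preserves its generator -/

section Generator

variable {E : Type*} [NormedAddCommGroup E] [NormedSpace ℝ E] {H : Type*} [TopologicalSpace H]
  {I : ModelWithCorners ℝ E H} {M : Type*} [TopologicalSpace M] [ChartedSpace H M]
  {E' : Type*} [NormedAddCommGroup E'] [NormedSpace ℝ E'] {H' : Type*} [TopologicalSpace H']
  {I' : ModelWithCorners ℝ E' H'} {M' : Type*} [TopologicalSpace M'] [ChartedSpace H' M']

/-- Chain rule for velocities: the velocity of `f ∘ c` at `s` is `df_{c s}(c'(s))`. [folklore] -/
theorem velocity_comp_of_mdifferentiableAt {f : M → M'} {c : ℝ → M} {s : ℝ}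
    (hf : MDifferentiableAt I I' f (c s)) (hc : MDifferentiableAt 𝓘(ℝ, ℝ) I c s) :
    velocity I' (f ∘ c) s = mfderiv I I' f (c s) (velocity I c s) := by
  unfold velocity
  rw [mfderiv_comp s hf hc]
  rfl

variable {X : Π x : M, TangentSpace I x} {θ : ℝ × M → M}

/-- **A flow preserves its generator: `dθₜ(X y) = X(θₜ y)`.** For a `C²` flow `θ` of `X` with the
group law, differentiating `s ↦ θ(t, θ(s, y)) = θ(t + s, y)` at `s = 0` gives
`dθₜ(X y) = X(θ(t, y))` (both sides are velocities of integral curves). Lee 2012, Prop. 9.13 /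
Thm. 9.12; O'Neill 1983, Ch. 1, Ex. and Ch. 9 (one-parameter groups). [cite: LeeSmoothManifolds2013, Thm. 9.12] -/
theorem mfderiv_flow_apply_self (hθ : ContMDiff (𝓘(ℝ, ℝ).prod I) I 2 θ)
    (hθ0 : ∀ p, θ (0, p) = p) (hθadd : ∀ t s p, θ (t, θ (s, p)) = θ (t + s, p))
    (hθX : ∀ p, IsMIntegralCurve (fun t ↦ θ (t, p)) X) (t : ℝ) (y : M) :
    mfderiv I I (fun q ↦ θ (t, q)) y (X y) = X (θ (t, y)) := by
  have hflow : MDifferentiableAt I I (fun q ↦ θ (t, q)) (θ (0, y)) :=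
    ((hθ.comp (contMDiff_const.prodMk contMDiff_id)).contMDiffAt).mdifferentiableAt two_ne_zero
  -- velocity of `s ↦ θ(t, θ(s, y))` at `0`, by the chain rule
  have h1 := velocity_comp_of_mdifferentiableAt (f := fun q ↦ θ (t, q)) (c := fun s ↦ θ (s, y))
    (s := 0) hflow (hθX y 0).mdifferentiableAt
  rw [velocity_eq_of_isMIntegralCurve (hθX y) 0] at h1
  -- the same curve is `s ↦ θ(s + t, y)`, an integral curve through `θ(t, y)`
  have hfun : ((fun q ↦ θ (t, q)) ∘ fun s ↦ θ (s, y)) = (fun s ↦ θ (s, y)) ∘ (· + t) := by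
    funext s
    simp only [comp_apply, hθadd, add_comm]
  have h2 := velocity_eq_of_isMIntegralCurve ((hθX y).comp_add t) 0
  rw [← hfun] at h2
  rw [h2] at h1
  -- `h1 : X (θ (t, θ (0, y))) = dθₜ (X (θ (0, y)))`, up to the base points
  simp only [comp_apply] at h1
  rw [hθ0] at h1
  exact h1.symm

end Generator

namespace LorentzianMetric

section HorizontalFlow

variable {E : Type*} [NormedAddCommGroup E] [NormedSpace ℝ E] [FiniteDimensional ℝ E]
  [CompleteSpace E] {M : Type*} [TopologicalSpace M] [ChartedSpace E M]
  [IsManifold 𝓘(ℝ, E) ∞ M] [T2Space M]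
  {g : LorentzianMetric 𝓘(ℝ, E) ∞ M} [g.HasLeviCivita] {τ : TimeOrientation g}
  {X : Π x : M, TangentSpace 𝓘(ℝ, E) x} {θ : ℝ × M → M}
  {F : Type*} [NormedAddCommGroup F] [NormedSpace ℝ F] [FiniteDimensional ℝ F]

/-- **`dπ ∘ dθₜ = dπ`**: the projection to the orbit space is invariant under the flow,
`π ∘ θₜ = π`, hence `dπ_{θₜ y}(dθₜ v) = dπ_y(v)` (chain rule). Anderson 2000, §0 (`π` is the
quotient by `G`). [cite: Anderson2000, §0] -/
theorem IsStationaryKilling.mfderiv_orbitProj_mfderiv_flow (h : g.IsStationaryKilling τ X univ)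
    (hchr : g.IsChronological τ) (hθ : ContMDiff (𝓘(ℝ, ℝ).prod 𝓘(ℝ, E)) 𝓘(ℝ, E) ∞ θ)
    (hθ0 : ∀ p, θ (0, p) = p) (hθadd : ∀ t s p, θ (t, θ (s, p)) = θ (t + s, p))
    (hθX : ∀ p, IsMIntegralCurve (fun t ↦ θ (t, p)) X)
    (hF : Module.finrank ℝ F + 1 = Module.finrank ℝ E) (t : ℝ) (y : M)
    (v : TangentSpace 𝓘(ℝ, E) y) :
    letI := h.orbitSpaceChartedSpace hchr (hθ.of_le (WithTop.coe_le_coe.mpr le_top)) hθ0 hθadd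
      hθX hF
    mfderiv 𝓘(ℝ, E) 𝓘(ℝ, F) (orbitProj X) (θ (t, y))
        (mfderiv 𝓘(ℝ, E) 𝓘(ℝ, E) (fun q ↦ θ (t, q)) y v) =
      mfderiv 𝓘(ℝ, E) 𝓘(ℝ, F) (orbitProj X) y v := by
  letI := h.orbitSpaceChartedSpace hchr (hθ.of_le (WithTop.coe_le_coe.mpr le_top)) hθ0 hθadd
    hθX hF
  have hπ := h.contMDiff_orbitProj hchr hθ hθ0 hθadd hθX hF
  have hθt : ContMDiff 𝓘(ℝ, E) 𝓘(ℝ, E) ∞ (fun q : M ↦ θ (t, q)) :=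
    hθ.comp (contMDiff_const.prodMk contMDiff_id)
  have hcomp := mfderiv_comp y ((hπ _).mdifferentiableAt (by simp))
    (hθt.contMDiffAt.mdifferentiableAt (by simp))
  have hinv : (orbitProj X ∘ fun q : M ↦ θ (t, q)) = orbitProj X := by
    funext q
    exact (orbitProj_eq_of_mem X ⟨fun s ↦ θ (s, q), hθX q, hθ0 q, t, rfl⟩).symm
  rw [hinv] at hcomp
  have := congrArg (fun L ↦ L v) hcomp
  exact this.symm

omit [FiniteDimensional ℝ F] [T2Space M] in
/-- **The flow maps horizontal vectors to horizontal vectors**: if `g(v, X y) = 0` then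
`g(dθₜ v, X(θₜ y)) = 0` — the flow maps are isometries (`IsKillingField.val_mfderiv_flow`) and
preserve the Killing field (`mfderiv_flow_apply_self`). Anderson 2000, §1.1 (the horizontal
distribution is `G`-invariant). [cite: Anderson2000, §1.1] -/
theorem IsStationaryKilling.horizontal_mfderiv_flow (h : g.IsStationaryKilling τ X univ)
    (hθ : ContMDiff (𝓘(ℝ, ℝ).prod 𝓘(ℝ, E)) 𝓘(ℝ, E) 2 θ)
    (hθ0 : ∀ p, θ (0, p) = p) (hθadd : ∀ t s p, θ (t, θ (s, p)) = θ (t + s, p))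
    (hθX : ∀ p, IsMIntegralCurve (fun t ↦ θ (t, p)) X) (t : ℝ) {y : M}
    {v : TangentSpace 𝓘(ℝ, E) y} (hv : g.val y v (X y) = 0) :
    g.val (θ (t, y)) (mfderiv 𝓘(ℝ, E) 𝓘(ℝ, E) (fun q ↦ θ (t, q)) y v) (X (θ (t, y))) = 0 := by
  rw [← mfderiv_flow_apply_self hθ hθ0 hθadd hθX t y,
    h.isKillingField.val_mfderiv_flow hθ hθ0 hθX t y v (X y), hv]

/-- **The horizontal lift is flow-equivariant: `H_{θₜ y} ζ = dθₜ (H_y ζ)`.** If `v` is the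
horizontal lift at `y` of `ζ ∈ T_{π y} S` and `w` is the horizontal lift at `θₜ y` of the same `ζ`,
then `w = dθₜ v` (uniqueness of the horizontal lift, `existsUnique_horizontal_lift`, since `dθₜ v`
is horizontal and `dπ(dθₜ v) = dπ v = ζ`). Anderson 2000, §0–§1.1. [cite: Anderson2000, §1.1] -/
theorem IsStationaryKilling.horizontal_lift_flow_eq (h : g.IsStationaryKilling τ X univ)
    (hchr : g.IsChronological τ) (hθ : ContMDiff (𝓘(ℝ, ℝ).prod 𝓘(ℝ, E)) 𝓘(ℝ, E) ∞ θ)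
    (hθ0 : ∀ p, θ (0, p) = p) (hθadd : ∀ t s p, θ (t, θ (s, p)) = θ (t + s, p))
    (hθX : ∀ p, IsMIntegralCurve (fun t ↦ θ (t, p)) X)
    (hF : Module.finrank ℝ F + 1 = Module.finrank ℝ E) (t : ℝ) (y : M)
    (ζ : F) {v : TangentSpace 𝓘(ℝ, E) y} {w : TangentSpace 𝓘(ℝ, E) (θ (t, y))} :
    letI := h.orbitSpaceChartedSpace hchr (hθ.of_le (WithTop.coe_le_coe.mpr le_top)) hθ0 hθadd
      hθX hF
    (g.val y v (X y) = 0 ∧ mfderiv 𝓘(ℝ, E) 𝓘(ℝ, F) (orbitProj X) y v = ζ) →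
    (g.val (θ (t, y)) w (X (θ (t, y))) = 0 ∧
      mfderiv 𝓘(ℝ, E) 𝓘(ℝ, F) (orbitProj X) (θ (t, y)) w = ζ) →
    w = mfderiv 𝓘(ℝ, E) 𝓘(ℝ, E) (fun q ↦ θ (t, q)) y v := by
  letI := h.orbitSpaceChartedSpace hchr (hθ.of_le (WithTop.coe_le_coe.mpr le_top)) hθ0 hθadd
    hθX hF
  rintro ⟨hv, hvζ⟩ hw
  have hθ2 : ContMDiff (𝓘(ℝ, ℝ).prod 𝓘(ℝ, E)) 𝓘(ℝ, E) 2 θ :=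
    hθ.of_le (WithTop.coe_le_coe.mpr le_top)
  have huniq := h.existsUnique_horizontal_lift hchr hθ hθ0 hθadd hθX hF (θ (t, y)) ζ
  refine huniq.unique hw ⟨h.horizontal_mfderiv_flow hθ2 hθ0 hθadd hθX t hv, ?_⟩
  rw [h.mfderiv_orbitProj_mfderiv_flow hchr hθ hθ0 hθadd hθX hF t y v, hvζ]

/-- **The horizontal inner product is constant along orbits** (well-definedness of Anderson's
quotient metric `g_S`): if `v, v'` are the horizontal lifts at `y` and `w, w'` the horizontal lifts
at `θₜ y` of the same tangent vectors `ζ, ζ'` of the orbit space, then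
`g_{θₜ y}(w, w') = g_y(v, v')` — `w = dθₜ v`, `w' = dθₜ v'` (`horizontal_lift_flow_eq`) and the flow
maps are isometries (`IsKillingField.val_mfderiv_flow`). Anderson 2000, §0 ("`g_M` restricted to the
horizontal subspaces … induces a Riemannian metric `g_S` on `S`"); O'Neill 1983, Ch. 7, Def. 7.44.
[cite: Anderson2000, §0] -/
theorem IsStationaryKilling.val_horizontal_lift_flow (h : g.IsStationaryKilling τ X univ)
    (hchr : g.IsChronological τ) (hθ : ContMDiff (𝓘(ℝ, ℝ).prod 𝓘(ℝ, E)) 𝓘(ℝ, E) ∞ θ)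
    (hθ0 : ∀ p, θ (0, p) = p) (hθadd : ∀ t s p, θ (t, θ (s, p)) = θ (t + s, p))
    (hθX : ∀ p, IsMIntegralCurve (fun t ↦ θ (t, p)) X)
    (hF : Module.finrank ℝ F + 1 = Module.finrank ℝ E) (t : ℝ) (y : M)
    (ζ ζ' : F) {v v' : TangentSpace 𝓘(ℝ, E) y} {w w' : TangentSpace 𝓘(ℝ, E) (θ (t, y))} :
    letI := h.orbitSpaceChartedSpace hchr (hθ.of_le (WithTop.coe_le_coe.mpr le_top)) hθ0 hθadd
      hθX hF
    (g.val y v (X y) = 0 ∧ mfderiv 𝓘(ℝ, E) 𝓘(ℝ, F) (orbitProj X) y v = ζ) →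
    (g.val y v' (X y) = 0 ∧ mfderiv 𝓘(ℝ, E) 𝓘(ℝ, F) (orbitProj X) y v' = ζ') →
    (g.val (θ (t, y)) w (X (θ (t, y))) = 0 ∧
      mfderiv 𝓘(ℝ, E) 𝓘(ℝ, F) (orbitProj X) (θ (t, y)) w = ζ) →
    (g.val (θ (t, y)) w' (X (θ (t, y))) = 0 ∧
      mfderiv 𝓘(ℝ, E) 𝓘(ℝ, F) (orbitProj X) (θ (t, y)) w' = ζ') →
    g.val (θ (t, y)) w w' = g.val y v v' := by
  letI := h.orbitSpaceChartedSpace hchr (hθ.of_le (WithTop.coe_le_coe.mpr le_top)) hθ0 hθadd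
    hθX hF
  intro hv hv' hw hw'
  have hθ2 : ContMDiff (𝓘(ℝ, ℝ).prod 𝓘(ℝ, E)) 𝓘(ℝ, E) 2 θ :=
    hθ.of_le (WithTop.coe_le_coe.mpr le_top)
  rw [h.horizontal_lift_flow_eq hchr hθ hθ0 hθadd hθX hF t y ζ hv hw,
    h.horizontal_lift_flow_eq hchr hθ hθ0 hθadd hθX hF t y ζ' hv' hw']
  exact h.isKillingField.val_mfderiv_flow hθ2 hθ0 hθX t y v v'

end HorizontalFlow

end LorentzianMetric

/-! ### The bundled form -/

namespace Spacetime

universe u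

variable {𝓢 : Spacetime.{u} 4} [𝓢.metric.HasLeviCivita]
  {X : Π x : 𝓢.carrier, TangentSpace (𝓡 4) x}

/-- `dim ℝ³ + 1 = dim ℝ⁴`. [folklore] -/
private lemma finrank_three_add_one''' :
    Module.finrank ℝ (EuclideanSpace ℝ (Fin 3)) + 1 =
      Module.finrank ℝ (EuclideanSpace ℝ (Fin 4)) := by
  simp [finrank_euclideanSpace]

/-- **Anderson 2000, §0, for a bundled spacetime: the horizontal inner product is constant along
the orbits of the stationary flow** `θ = hX.flow` (well-definedness of `g_S` on the orbit
3-manifold). [cite: Anderson2000, §0] -/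
theorem IsStationaryKilling.val_horizontal_lift_flow (hX : 𝓢.IsStationaryKilling X univ)
    (hchr : 𝓢.metric.IsChronological 𝓢.timeOrientation) (t : ℝ) (y : 𝓢.carrier)
    (ζ ζ' : EuclideanSpace ℝ (Fin 3)) {v v' : TangentSpace (𝓡 4) y}
    {w w' : TangentSpace (𝓡 4) (hX.flow (t, y))} :
    letI := hX.orbitSpaceChartedSpace hchr
    (𝓢.metric.val y v (X y) = 0 ∧ mfderiv (𝓡 4) (𝓡 3) (orbitProj X) y v = ζ) →
    (𝓢.metric.val y v' (X y) = 0 ∧ mfderiv (𝓡 4) (𝓡 3) (orbitProj X) y v' = ζ') →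
    (𝓢.metric.val (hX.flow (t, y)) w (X (hX.flow (t, y))) = 0 ∧
      mfderiv (𝓡 4) (𝓡 3) (orbitProj X) (hX.flow (t, y)) w = ζ) →
    (𝓢.metric.val (hX.flow (t, y)) w' (X (hX.flow (t, y))) = 0 ∧
      mfderiv (𝓡 4) (𝓡 3) (orbitProj X) (hX.flow (t, y)) w' = ζ') →
    𝓢.metric.val (hX.flow (t, y)) w w' = 𝓢.metric.val y v v' :=
  LorentzianMetric.IsStationaryKilling.val_horizontal_lift_flow hX hchr hX.contMDiff_flow
    hX.flow_zero hX.flow_add hX.isMIntegralCurve_flow finrank_three_add_one''' t y ζ ζ'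

end Spacetime

end Literature.Geometry.Lorentzian

end
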